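import Summits.QuantumFields.BalabanUV.Beta.FP.TowerDoorGaugeRefDefs
import Summits.QuantumFields.BalabanUV.Beta.NVertexSectors

/-!
# `BalabanUV.Beta.FP.TowerDoorGaugeBound` — binder row D1, the row's ONE file, STUB P (P-c) ∕ (X): **THE LATTICE GAUGE FUNCTION `λℤ_(μ,z)` IS EXPONENTIALLY LOCALISED AT THE SOURCE BLOCK `L•z`**
# — `|lamZ … A μ z u| ≤ K · e^{−δ·|L•z − u|₁}` for every `δ`-decaying chart `A`, with `K` depending on the reference tower's three finite matrices, the chart's constant and `δ` only; hence
# `λℤ_(μ,z)` is bounded, absolutely summable over the sites `u`, and absolutely summable over the sources `z` UNIFORMLY in `u` (the summability letters the door's (X)∕(U)∕`hWΔ₂` bookkeeping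
# consumes — J-NOTE-20 §3 (b)(d)); for the record's chart by the row's `decays_AN`
# (β-function cell `pub-balaban`, BINDER-OWNERS row D1 ∕ (C1) OWNER «beta-an2» gen 77, PART 59; imports PART 55 + the row's `NVertexSectors`)

WHAT ([folklore] finite `Matrix` ∕ `ℓ¹` bookkeeping BY NAME; no `def`, no `def … : Prop`, nothing cited, 0 sorry, default heartbeats).
§1 generic: `abs_mulVec_apply_le` (`|(M *ᵥ X) i| ≤ (Σ_b |M i b|)·Σ_b |X b|`), `abs_readout_mulVec_le` (the `hlve`-shaped read-out of `M *ᵥ X` is bounded by `(Σ_x Σ_b |M (eqv x) b|)·Σ_b |X b|`),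
`l1_sub_le_of_mem_pbox` (two points of a box are within `Σ_i M i` in `ℓ¹`), `l1_zsmul_sub_le` (the block-covariance triangle `|L•z − u|₁ ≤ |p − L•(z − q)|₁ + |p − r|₁` for `r = u − L•q`).
§2 (generic `d`, kernel-generic, any `lev rs hrs`): **`exists_abs_lamZ_le_sum`** — `∃ K ≥ 0, ∀ A μ z u, |lamZ … A μ z u| ≤ K · Σ_b |A ↑b.1 (L•(z − quo L u)) (inl b.2) (inr μ)|` (`K` = the entry sum of
`towerEvalC · ((refSlice·towerGen)⁻¹ · refSlice)` read at the residual slots; `lamZ` is `−`the read-out of `−(N·W₀)⁻¹·N·refCol`); **`exists_abs_lamZ_le_exp`** — for `Decays A C δ` (`0 ≤ δ`):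
`∃ K ≥ 0, ∀ μ z u, |lamZ … A μ z u| ≤ K · exp (−δ · l1 (L•z − u))` (each reference bond `p` and the representative `r` of `u` lie in the one-block box, so `|p − L•(z − quo L u)|₁ ≥ |L•z − u|₁ − (d+1)·L`);
corollaries `exists_abs_lamZ_le` (uniform bound), **`summable_abs_lamZ_sites`** (`Σ_u |λℤ_(μ,z)(u)| < ∞`), **`summable_abs_lamZ_sources`** (`Σ_z |λℤ_(μ,z)(u)| < ∞`) and **`exists_tsum_abs_lamZ_sources_le`**
(`∃ B, ∀ μ u, Σ'_z |λℤ_(μ,z)(u)| ≤ B` — uniform in the site, lit `Zl` ∕ `tsum_exp_shift'` over the injective source map `z ↦ L•z`).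
§3 (`d = 3`) the record's chart `scaleK σ σ (AN R (n+1))`: `decays_scaleK_AN` (the row's `decays_AN` + lit `decays_scaleK`), **`exists_abs_lamZ_record_le_exp`** and the three summability corollaries, hypothesis-free.
WHAT THIS IS NOT: not the door's Defs ∕ (X) ∕ (T2) ∕ `hWΔ₂`; nothing of Bałaban's asserted, valued or discharged; 0 estimates of Bałaban's (the bounds here are bookkeeping constants of OUR finite reference
matrices, existentially quantified, no size claimed); 0∕4 row-D1 binders (hW, hR, D1Tel, D1Rep); v10 NOT filed; v9 p617999 stands; NOT (C1), NOT (T-ID), NOT D1, NEVER «G-an2-4 closed», NOT BetaPertH, NOT continuum, NOT Clay.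

HONEST DEPENDENCY (page 1, mandatory): continuum YM on T⁴ ⇐ BetaPertH ∧ nine spine estimates (0/9 proved); BetaPertH ⇐ (D1) ∧ (D4) ∧ CAP+tail;
G-an2-4 gates asym, D1 and NE2/3/4.  HONEST FRAMING (cell contract, verbatim): «discharging `BetaPertH` makes Bałaban's UV stability UNCONDITIONAL —
a real constructive-QFT result; it is NOT the continuum limit and NOT the Clay problem.»  ABSOLUTE RULE (cell charter, verbatim): «No internally-minted
statement may enter as a cited fact. Every hypothesis is either kernel-proved in this package or a verbatim quotation of a PUBLISHED theorem with page
reference. The manuscript(s) under audit are NOT citable for their own disputed steps — they are the thing under adjudication; programme-internal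
(2001/route/tribunal) claims are never citable.»  Row D1 ∕ (C1) OWNER «beta-an2» gen 77, 2026-08-29.  No existing file touched.
-/

noncomputable section

open Finset Matrix
open scoped BigOperators
open Literature.MathematicalPhysics.QuantumFieldTheory
open Literature.MathematicalPhysics.QuantumFieldTheory.Balaban1983to89
open Literature.MathematicalPhysics.QuantumFieldTheory.Balaban1983to89.Beta
open Literature.MathematicalPhysics.QuantumFieldTheory.Balaban1983to89.B12Sec2to5 (l1 l1_nonneg)
open B5Prop11Plancherel (fine)
open B6Lemma24Torus (pbox mem_pbox)
open AffineAveraging (Site box toSite unitVec)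
open OneStepResolventKernel (Fib)
open ExpKernelCalculus (MKer Decays l1_sub_triangle l1_sub_symm Zl Zl_nonneg summable_exp_shift summable_exp_shift' tsum_exp_shift')
open HessKerRate (scaleK decays_scaleK)
open Literature.MathematicalPhysics.QuantumFieldTheory.LatticeForm (quo)
open Summit.QuantumFields.BalabanUV.Beta.CompositeOneShotJetData (Roots AN)
open Summit.QuantumFields.BalabanUV.Beta.NVertexSectors (decays_AN)
open Summit.QuantumFields.BalabanUV.Beta.FP.TorusCombRows (Res)
open Summit.QuantumFields.BalabanUV.Beta.FP.TorusCompositeObjects (towerTorus NParam combF bigP towerGen bigRoot bigRatio bigRatio_eq_pow bigRatio_pos towerEquiv)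
open Summit.QuantumFields.BalabanUV.Beta.FP.TorusCompositeUnimodular (towerEvalC)
open Summit.QuantumFields.BalabanUV.Beta.FP.TorusReferenceBlock (towerTorus_ref_apply sub_zsmul_quo_mem_pbox_ref)
open Summit.QuantumFields.BalabanUV.Beta.FP.TowerDoorGaugeRefDefs

namespace Summit.QuantumFields.BalabanUV.Beta.FP.TowerDoorGaugeBound

variable {d : ℕ}

/-! ## §1 Generic bounds -/

section Generic

/-- [folklore] `|(M *ᵥ X) i| ≤ (Σ_b |M i b|) · Σ_b |X b|`. -/
theorem abs_mulVec_apply_le {ι κ : Type*} [Fintype κ] (M : Matrix ι κ ℝ) (X : κ → ℝ) (i : ι) :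
    |(M *ᵥ X) i| ≤ (∑ b, |M i b|) * ∑ b, |X b| := by
  rw [Matrix.mulVec, dotProduct]
  refine (Finset.abs_sum_le_sum_abs _ _).trans ?_
  rw [Finset.sum_mul]
  refine Finset.sum_le_sum fun b _ => ?_
  rw [abs_mul]
  exact mul_le_mul_of_nonneg_left (Finset.single_le_sum (fun b' _ => abs_nonneg (X b')) (Finset.mem_univ b)) (abs_nonneg _)

/-- [folklore] **the `hlve`-shaped read-out of `M *ᵥ X` is bounded by `(Σ_x Σ_b |M (eqv x) b|) · Σ_b |X b|`.** -/
theorem abs_readout_mulVec_le {ι κ ρ σ : Type*} [Fintype κ] [Fintype ρ] [DecidableEq σ] (M : Matrix ι κ ℝ) (pt : ρ → σ) (eqv : ρ → ι) (s : σ)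
    (X : κ → ℝ) :
    |∑ x : ρ, (if pt x = s then (M *ᵥ X) (eqv x) else 0)| ≤ (∑ x : ρ, ∑ b, |M (eqv x) b|) * ∑ b, |X b| := by
  refine (Finset.abs_sum_le_sum_abs _ _).trans ?_
  rw [Finset.sum_mul]
  refine Finset.sum_le_sum fun x _ => ?_
  split_ifs
  · exact abs_mulVec_apply_le M X (eqv x)
  · rw [abs_zero]
    exact mul_nonneg (Finset.sum_nonneg fun b _ => abs_nonneg _) (Finset.sum_nonneg fun b _ => abs_nonneg _)

/-- [folklore] two points of the box `pbox M` are within `Σ_i M i` of each other in `ℓ¹`. -/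
theorem l1_sub_le_of_mem_pbox {M : Fin (d + 1) → ℕ} {p r : Site (d + 1)} (hp : p ∈ pbox M) (hr : r ∈ pbox M) :
    l1 (p - r) ≤ ∑ i, (M i : ℝ) := by
  rw [mem_pbox] at hp hr
  unfold l1
  refine Finset.sum_le_sum fun i _ => ?_
  have h1 := hp i
  have h2 := hr i
  rw [Pi.sub_apply, Int.cast_sub, abs_le]
  constructor
  · have : ((r i : ℤ) : ℝ) < (M i : ℝ) := by exact_mod_cast h2.2
    have : (0 : ℝ) ≤ ((p i : ℤ) : ℝ) := by exact_mod_cast h1.1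
    linarith
  · have : ((p i : ℤ) : ℝ) < (M i : ℝ) := by exact_mod_cast h1.2
    have : (0 : ℝ) ≤ ((r i : ℤ) : ℝ) := by exact_mod_cast h2.1
    linarith

/-- [folklore] the block-covariance triangle: with `r := u + L•(−q)`, `|L•z − u|₁ ≤ |p − L•(z − q)|₁ + |p − r|₁` for any `p`. -/
theorem l1_zsmul_sub_le (L : ℤ) (z q u p : Site (d + 1)) :
    l1 (L • z - u) ≤ l1 (p - L • (z - q)) + l1 (p - (u + L • (-q))) := by
  have e : L • z - u = L • (z - q) - (u + L • (-q)) := by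
    simp only [smul_sub, smul_neg]; abel
  rw [e, l1_sub_symm p (L • (z - q))]
  exact l1_sub_triangle (L • (z - q)) p (u + L • (-q))

end Generic

/-! ## §2 The lattice gauge function is bounded by the column, and exponentially localised for a decaying chart -/

section LamZ

variable (Lc : ℕ) [NeZero Lc] (lev : ℕ → ℕ) (rs : ℕ → (Fin (d + 1) → ℕ))
  (hrs : ∀ k i, 0 ≤ toSite (rs k) i ∧ toSite (rs k) i < (Lc : ℤ)) (n : ℕ)

/-- [folklore] **`exists_abs_lamZ_le_sum`** — `|lamZ … A μ z u| ≤ K · Σ_b |A ↑b.1 (L•(z − quo L u)) (inl b.2) (inr μ)|` with ONE constant `K ≥ 0` for all kernels, legs, sources and sites (the entry sum of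
`towerEvalC · (−((refSlice·towerGen)⁻¹ · refSlice))` read at the residual slots — OUR finite reference matrices; no size claimed). -/
theorem exists_abs_lamZ_le_sum : ∃ K : ℝ, 0 ≤ K ∧ ∀ (A : MKer (d + 1) (Fib d)) (μ : Fin (d + 1)) (z u : Site (d + 1)),
    |lamZ Lc lev rs hrs n A μ z u|
      ≤ K * ∑ b : ↥(pbox (towerTorus Lc (fun _ : Fin (d + 1) => Lc) (n + 1))) × Fin (d + 1),
          |A (b.1 : Site (d + 1)) (((bigRatio Lc (n + 1) : ℕ) : ℤ) • (z - quo (bigRatio Lc (n + 1)) u)) (Sum.inl b.2) (Sum.inr μ)| := by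
  set M : Matrix (NParam Lc (fun _ : Fin (d + 1) => Lc) rs (n + 1)) (↥(pbox (towerTorus Lc (fun _ : Fin (d + 1) => Lc) (n + 1))) × Fin (d + 1)) ℝ :=
    towerEvalC Lc (fun _ : Fin (d + 1) => Lc) rs hrs (n + 1)
      * -((refSlice Lc lev rs hrs n * towerGen Lc (fun _ : Fin (d + 1) => Lc) rs (n + 1))⁻¹ * refSlice Lc lev rs hrs n) with hM
  refine ⟨∑ x : Res (bigRoot Lc rs (n + 1)) (bigRatio Lc (n + 1)) (towerTorus Lc (fun _ : Fin (d + 1) => Lc) (n + 1)),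
      ∑ b, |M (towerEquiv Lc (fun _ : Fin (d + 1) => Lc) rs hrs (n + 1) x) b|,
    Finset.sum_nonneg fun x _ => Finset.sum_nonneg fun b _ => abs_nonneg _, fun A μ z u => ?_⟩
  have e : towerEvalC Lc (fun _ : Fin (d + 1) => Lc) rs hrs (n + 1) *ᵥ refTheta Lc lev rs hrs n A μ (z - quo (bigRatio Lc (n + 1)) u)
      = M *ᵥ refCol Lc n A μ (z - quo (bigRatio Lc (n + 1)) u) := by
    rw [refTheta_eq, hM, ← Matrix.mulVec_mulVec, Matrix.neg_mulVec, ← Matrix.mulVec_mulVec]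
  rw [lamZ_eq, abs_neg, e]
  exact abs_readout_mulVec_le M _ _ _ _

/-- [folklore] **`exists_abs_lamZ_le_exp` — EXPONENTIAL LOCALISATION AT THE SOURCE BLOCK**: for a `δ`-decaying kernel (`Decays A C δ`, `0 ≤ δ`), `∃ K ≥ 0, ∀ μ z u,
|lamZ … A μ z u| ≤ K · exp (−δ · |L•z − u|₁)` (every reference bond `p` and the representative `r = u − L•quo L u` lie in the one-block box `[0,L)^{d+1}`: `|p − L•(z − quo L u)|₁ ≥ |L•z − u|₁ − (d+1)·L`). -/
theorem exists_abs_lamZ_le_exp {A : MKer (d + 1) (Fib d)} {C δ : ℝ} (hA : Decays A C δ) (hδ : 0 ≤ δ) :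
    ∃ K : ℝ, 0 ≤ K ∧ ∀ (μ : Fin (d + 1)) (z u : Site (d + 1)),
      |lamZ Lc lev rs hrs n A μ z u| ≤ K * Real.exp (-δ * l1 ((((bigRatio Lc (n + 1) : ℕ) : ℤ) • z) - u)) := by
  obtain ⟨K, hK, h⟩ := exists_abs_lamZ_le_sum Lc lev rs hrs n
  have hC : 0 ≤ C := hA.nonneg (Sum.inl 0)
  set L : ℕ := bigRatio Lc (n + 1) with hL
  set D₀ : ℝ := ∑ i : Fin (d + 1), (towerTorus Lc (fun _ : Fin (d + 1) => Lc) (n + 1) i : ℝ) with hD₀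
  refine ⟨K * ((Fintype.card (↥(pbox (towerTorus Lc (fun _ : Fin (d + 1) => Lc) (n + 1))) × Fin (d + 1)) : ℝ) * (C * Real.exp (δ * D₀))),
    mul_nonneg hK (mul_nonneg (Nat.cast_nonneg _) (mul_nonneg hC (Real.exp_pos _).le)), fun μ z u => ?_⟩
  refine (h A μ z u).trans ?_
  rw [mul_assoc]
  refine mul_le_mul_of_nonneg_left ?_ hK
  -- each bond's entry is bounded by `C·e^{δ D₀}·e^{−δ |L•z − u|₁}`
  have hb : ∀ b : ↥(pbox (towerTorus Lc (fun _ : Fin (d + 1) => Lc) (n + 1))) × Fin (d + 1),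
      |A (b.1 : Site (d + 1)) (((L : ℕ) : ℤ) • (z - quo L u)) (Sum.inl b.2) (Sum.inr μ)|
        ≤ C * Real.exp (δ * D₀) * Real.exp (-δ * l1 ((((L : ℕ) : ℤ) • z) - u)) := by
    intro b
    refine (hA _ _ _ _).trans ?_
    rw [mul_assoc, ← Real.exp_add]
    refine mul_le_mul_of_nonneg_left (Real.exp_le_exp.mpr ?_) hC
    have ht := l1_zsmul_sub_le (((L : ℕ) : ℤ)) z (quo L u) u (b.1 : Site (d + 1))
    have hD : l1 ((b.1 : Site (d + 1)) - (u + (((L : ℕ) : ℤ)) • (-quo L u))) ≤ D₀ :=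
      l1_sub_le_of_mem_pbox b.1.2 (sub_zsmul_quo_mem_pbox_ref Lc n u)
    nlinarith [l1_nonneg ((b.1 : Site (d + 1)) - (((L : ℕ) : ℤ)) • (z - quo L u)), l1_nonneg ((((L : ℕ) : ℤ) • z) - u)]
  refine (Finset.sum_le_sum fun b _ => hb b).trans ?_
  rw [Finset.sum_const, nsmul_eq_mul, Finset.card_univ]
  exact le_of_eq (by ring)

/-- [folklore] … hence `λℤ` is UNIFORMLY BOUNDED. -/
theorem exists_abs_lamZ_le {A : MKer (d + 1) (Fib d)} {C δ : ℝ} (hA : Decays A C δ) (hδ : 0 ≤ δ) :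
    ∃ K : ℝ, 0 ≤ K ∧ ∀ (μ : Fin (d + 1)) (z u : Site (d + 1)), |lamZ Lc lev rs hrs n A μ z u| ≤ K := by
  obtain ⟨K, hK, h⟩ := exists_abs_lamZ_le_exp Lc lev rs hrs n hA hδ
  refine ⟨K, hK, fun μ z u => (h μ z u).trans ?_⟩
  have : Real.exp (-δ * l1 ((((bigRatio Lc (n + 1) : ℕ) : ℤ) • z) - u)) ≤ 1 :=
    Real.exp_le_one_iff.mpr (by nlinarith [l1_nonneg ((((bigRatio Lc (n + 1) : ℕ) : ℤ) • z) - u)])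
  nlinarith

/-- [folklore] **`summable_abs_lamZ_sites`** — `λℤ_(μ,z)` is absolutely summable over the lattice sites (`0 < δ`; lit `summable_exp_shift`). -/
theorem summable_abs_lamZ_sites {A : MKer (d + 1) (Fib d)} {C δ : ℝ} (hA : Decays A C δ) (hδ : 0 < δ) (μ : Fin (d + 1)) (z : Site (d + 1)) :
    Summable (fun u : Site (d + 1) => |lamZ Lc lev rs hrs n A μ z u|) := by
  obtain ⟨K, hK, h⟩ := exists_abs_lamZ_le_exp Lc lev rs hrs n hA hδ.le
  refine Summable.of_nonneg_of_le (fun u => abs_nonneg _) (fun u => h μ z u) ?_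
  exact (summable_exp_shift hδ ((((bigRatio Lc (n + 1) : ℕ) : ℤ) • z))).mul_left K

/-- [folklore] **`summable_abs_lamZ_sources`** — `z ↦ λℤ_(μ,z)(u)` is absolutely summable over the sources (`0 < δ`; the source map `z ↦ L•z` is injective, lit `summable_exp_shift'`). -/
theorem summable_abs_lamZ_sources {A : MKer (d + 1) (Fib d)} {C δ : ℝ} (hA : Decays A C δ) (hδ : 0 < δ) (μ : Fin (d + 1)) (u : Site (d + 1)) :
    Summable (fun z : Site (d + 1) => |lamZ Lc lev rs hrs n A μ z u|) := by
  obtain ⟨K, hK, h⟩ := exists_abs_lamZ_le_exp Lc lev rs hrs n hA hδ.le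
  have hL : (((bigRatio Lc (n + 1) : ℕ) : ℤ)) ≠ 0 := by exact_mod_cast (bigRatio_pos Lc (Nat.pos_of_ne_zero (NeZero.ne Lc)) (n + 1)).ne'
  have hinj : Function.Injective (fun z : Site (d + 1) => (((bigRatio Lc (n + 1) : ℕ) : ℤ)) • z) := smul_right_injective _ hL
  refine Summable.of_nonneg_of_le (fun z => abs_nonneg _) (fun z => h μ z u) ?_
  exact (((summable_exp_shift' hδ u).comp_injective hinj)).mul_left K

/-- [folklore] **`exists_tsum_abs_lamZ_sources_le`** — the source sum of `|λℤ|` is bounded UNIFORMLY in the site: `∃ B, ∀ μ u, Σ'_z |lamZ … A μ z u| ≤ B` (`0 < δ`; a sub-series of the lattice constant `Zl δ`). -/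
theorem exists_tsum_abs_lamZ_sources_le {A : MKer (d + 1) (Fib d)} {C δ : ℝ} (hA : Decays A C δ) (hδ : 0 < δ) :
    ∃ B : ℝ, 0 ≤ B ∧ ∀ (μ : Fin (d + 1)) (u : Site (d + 1)), (∑' z : Site (d + 1), |lamZ Lc lev rs hrs n A μ z u|) ≤ B := by
  obtain ⟨K, hK, h⟩ := exists_abs_lamZ_le_exp Lc lev rs hrs n hA hδ.le
  have hL : (((bigRatio Lc (n + 1) : ℕ) : ℤ)) ≠ 0 := by exact_mod_cast (bigRatio_pos Lc (Nat.pos_of_ne_zero (NeZero.ne Lc)) (n + 1)).ne'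
  have hinj : Function.Injective (fun z : Site (d + 1) => (((bigRatio Lc (n + 1) : ℕ) : ℤ)) • z) := smul_right_injective _ hL
  refine ⟨K * Zl (d + 1) δ, mul_nonneg hK (Zl_nonneg hδ), fun μ u => ?_⟩
  have hs : Summable (fun z : Site (d + 1) => Real.exp (-δ * l1 ((((bigRatio Lc (n + 1) : ℕ) : ℤ) • z) - u))) :=
    (summable_exp_shift' hδ u).comp_injective hinj
  have h1 : (∑' z : Site (d + 1), |lamZ Lc lev rs hrs n A μ z u|) ≤ ∑' z : Site (d + 1), K * Real.exp (-δ * l1 ((((bigRatio Lc (n + 1) : ℕ) : ℤ) • z) - u)) :=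
    (Summable.of_nonneg_of_le (fun z => abs_nonneg _) (fun z => h μ z u) (hs.mul_left K)).tsum_le_tsum (fun z => h μ z u) (hs.mul_left K)
  refine h1.trans ?_
  rw [tsum_mul_left]
  refine mul_le_mul_of_nonneg_left ?_ hK
  rw [← tsum_exp_shift' (c := δ) u]
  exact tsum_comp_le_tsum_of_inj (summable_exp_shift' hδ u) (fun y => (Real.exp_pos _).le) hinj

end LamZ

/-! ## §3 The record's chart `σ·AN·σ` -/

section Record

variable {Lc : ℕ} [NeZero Lc] (R : Roots Lc) (lev : ℕ → ℕ) (rs : ℕ → (Fin (3 + 1) → ℕ))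
  (hrs : ∀ k i, 0 ≤ toSite (rs k) i ∧ toSite (rs k) i < (Lc : ℤ)) (n : ℕ) (σ : Fib 3 → ℝ)

/-- [folklore] the `σ`-conjugated chart decays (the row's `decays_AN` + lit `decays_scaleK`, `|σ| ≤ Σ |σ a|`). -/
theorem decays_scaleK_AN (j : ℕ) : ∃ δ C : ℝ, 0 < δ ∧ 0 ≤ C ∧ Decays (scaleK σ σ (AN R j)) C δ := by
  obtain ⟨δ, C, hδ, hC, hA⟩ := decays_AN R j
  have hσ : ∀ a : Fib 3, |σ a| ≤ ∑ a', |σ a'| := fun a => Finset.single_le_sum (fun a' _ => abs_nonneg (σ a')) (Finset.mem_univ a)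
  exact ⟨δ, (∑ a', |σ a'|) * C * ∑ a', |σ a'|, hδ,
    mul_nonneg (mul_nonneg (Finset.sum_nonneg fun _ _ => abs_nonneg _) hC) (Finset.sum_nonneg fun _ _ => abs_nonneg _), decays_scaleK hσ hσ hA⟩

/-- [folklore] **`exists_abs_lamZ_record_le_exp` — THE RECORD's `λℤ` IS EXPONENTIALLY LOCALISED AT THE SOURCE BLOCK**, hypothesis-free:
`∃ δ > 0, ∃ K ≥ 0, ∀ μ z u, |lamZ Lc lev rs hrs n (scaleK σ σ (AN R (n+1))) μ z u| ≤ K · exp (−δ · |L•z − u|₁)`. -/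
theorem exists_abs_lamZ_record_le_exp : ∃ δ : ℝ, 0 < δ ∧ ∃ K : ℝ, 0 ≤ K ∧ ∀ (μ : Fin (3 + 1)) (z u : Site (3 + 1)),
    |lamZ Lc lev rs hrs n (scaleK σ σ (AN R (n + 1))) μ z u| ≤ K * Real.exp (-δ * l1 ((((bigRatio Lc (n + 1) : ℕ) : ℤ) • z) - u)) := by
  obtain ⟨δ, C, hδ, _, hA⟩ := decays_scaleK_AN R σ (n + 1)
  exact ⟨δ, hδ, exists_abs_lamZ_le_exp Lc lev rs hrs n hA hδ.le⟩

/-- [folklore] the record's `λℤ_(μ,z)` is absolutely summable over the sites. -/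
theorem summable_abs_lamZ_record_sites (μ : Fin (3 + 1)) (z : Site (3 + 1)) :
    Summable (fun u : Site (3 + 1) => |lamZ Lc lev rs hrs n (scaleK σ σ (AN R (n + 1))) μ z u|) := by
  obtain ⟨δ, C, hδ, _, hA⟩ := decays_scaleK_AN R σ (n + 1)
  exact summable_abs_lamZ_sites Lc lev rs hrs n hA hδ μ z

/-- [folklore] the record's `z ↦ λℤ_(μ,z)(u)` is absolutely summable over the sources. -/
theorem summable_abs_lamZ_record_sources (μ : Fin (3 + 1)) (u : Site (3 + 1)) :
    Summable (fun z : Site (3 + 1) => |lamZ Lc lev rs hrs n (scaleK σ σ (AN R (n + 1))) μ z u|) := by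
  obtain ⟨δ, C, hδ, _, hA⟩ := decays_scaleK_AN R σ (n + 1)
  exact summable_abs_lamZ_sources Lc lev rs hrs n hA hδ μ u

/-- [folklore] the record's source sum of `|λℤ|` is bounded uniformly in the site. -/
theorem exists_tsum_abs_lamZ_record_sources_le : ∃ B : ℝ, 0 ≤ B ∧ ∀ (μ : Fin (3 + 1)) (u : Site (3 + 1)),
    (∑' z : Site (3 + 1), |lamZ Lc lev rs hrs n (scaleK σ σ (AN R (n + 1))) μ z u|) ≤ B := by
  obtain ⟨δ, C, hδ, _, hA⟩ := decays_scaleK_AN R σ (n + 1)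
  exact exists_tsum_abs_lamZ_sources_le Lc lev rs hrs n hA hδ

end Record

end Summit.QuantumFields.BalabanUV.Beta.FP.TowerDoorGaugeBound

end
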